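import Literature.NumberTheory.LFunctions.WeilExplicit
import Literature.NumberTheory.LFunctions.WeilCriterionProofs
import HarnessLib

/-!
# Yoshida's odd-sector form of Weil's criterion (Yoshida 1992, Proposition 1(1))

H. Yoshida, *On Hermitian forms attached to zeta functions*, in: N. Kurokawa, T. Sunada (eds.),
Zeta Functions in Geometry, Adv. Stud. Pure Math. **21** (1992), 281–325 (bib
`Yoshida1992HermitianForms`; held copy `paper:url-4f57c7fe9c4c`), §1, Proposition 1 (p. 285, proof
pp. 286–287):

> Let `T` be a distribution on `ℝ`. `T` is *positive definite* if `T(α * α̃) ≥ 0` for every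
> `α ∈ C_c^∞(ℝ)`, and *evenly* (resp. *oddly*) positive definite if `T(α * α̃) ≥ 0` for every even
> (resp. odd) `α ∈ C_c^∞(ℝ)`. It is a well known observation of Weil that `T_k` is positive definite
> iff the Riemann hypothesis holds for `ζ_k(s)`.
> **Proposition 1.** (1) `T_k` is oddly positive definite if and only if R.H. holds for `ζ_k(s)`.
> (2) `T_k` is evenly positive definite if and only if R.H. holds for `ζ_k(s)` with possible
> exceptions of real zeros.

Here `k` is a number field, `T_k(F) = lim_{T → ∞} ∑_{|Im ρ| < T} Φ(ρ)` is the ZERO-SIDE distribution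
of the Dedekind zeta function `ζ_k` (p. 284; `ρ` over the non-trivial zeros),
`Φ = M(F)`, `M(α)(s) = ∫ α(x) e^{(s - 1/2)x} dx` (p. 283), `α̃(x) = conj α(-x)`, `α̌(x) = α(-x)`,
`*` = additive convolution, with `M(α̌)(s) = M(α)(1 - s)`, `M(α̃)(s) = conj M(α)(1 - s̄)`,
`M(α * β) = M(α) M(β)` ((1.1)–(1.3), p. 283).

## Dictionary with the tree (`WeilExplicit.lean`) and the case `k = ℚ`

Yoshida's normalisation IS the tree's: `M(α) = weilMellin α`, `α̃ = weilReflect α`,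
`α * β = weilConv α β`, `C_c^∞(ℝ) = IsWeilTest`, and for `k = ℚ` the zero side `T_ℚ(α * α̃)` is the
symmetric limit `HasWeilZeroSide (weilConv α (weilReflect α)) ·` of the tree, which by the explicit
formula (Yoshida (1.6); in the tree the DISCHARGED fact `explicit_formula_holds`,
`WeilExplicitFormulaProofs.lean`) equals `W(α ⋆ α̃) = weilQuadratic α`. So for `k = ℚ`
Proposition 1(1) reads, in the tree's vocabulary,

  `RiemannHypothesis ↔ ∀ g, IsWeilTest g → (∀ t, g (-t) = -g t) → 0 ≤ Re (weilQuadratic g)`,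

which is the named fact `yoshida_odd_criterion` below (`TODO(general form)`: Dedekind `ζ_k`; the
tree's Weil functional is set up for `ζ` only). It sharpens the parity-free Weil criterion, which
the tree PROVES (`weil_criterion_holds : RiemannHypothesis ↔ WeilPositivity`,
`WeilCriterionProofs.lean`; converse by two-node translate families `translateMix`,
`WeilConverse.riemannHypothesis_of_zeroSide_nonneg`, which are never odd).

## The printed proof (pp. 285–287), for the discharge

* "If": under RH `1 - ρ = ρ̄`, so `T(α * α̃) = ∑_ρ |Φ₀(ρ)|² ≥ 0` (`Φ₀ = M(α)`) for every `α`, odd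
  or not. In the tree: `WeilPositivity.of_riemannHypothesis explicit_formula_holds`; recorded below as
  the theorem `yoshida_odd_criterion_mp` (this half is PROVED here).
* "Only if" (Lemma 1, p. 285): given a non-trivial zero `ρ₀` and `ε > 0` there is `α ∈ C_c^∞(ℝ)`
  with `M(α)(ρ₀) = 1` and `|M(α)(ρ)| ≤ ε/|ρ - ρ₀|²` at every other zero (start from `α₀` with
  `M(α₀)(ρ₀) = 1` and `M(α₀) = O(|s - 1/2|⁻³)` in the strip, kill the finitely many zeros with
  `|ρ - ρ₀| < R` by convolution factors `αᵢ` with `M(αᵢ)(ρ₀) = 1`, `M(αᵢ)(ρᵢ) = 0`, and convolve with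
  `N` copies of `α₀`). If `Re ρ₀ ≠ 1/2`, take such `α₁` for `ρ₀` and `α₂` for `ρ̄₀` and the ODD test
  function `a = α₁ + α₂ - α̌₁ - α̌₂`: with `Φ₀ = M(α₁ + α₂)`,
  `M(a * ã)(s) = (Φ₀(s) - Φ₀(1 - s)) (conj Φ₀(1 - s̄) - conj Φ₀(s̄))`, whose values at
  `ρ₀, ρ̄₀, 1 - ρ₀, 1 - ρ̄₀` tend to `-1` (to `-4` if `ρ₀` is real) as `ε → 0`, while the remaining
  zeros contribute `O(ε²) · ∑_ρ |ρ - η|⁻⁴`-type convergent sums; so `T(a * ã) < 0` for small `ε`.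

A Summit-side theorem proves a STRONGER odd criterion for `ζ` by a different (one-sided Landau-type)
engine: `Summit.RiemannHypothesis.RiemannHypothesis.Theorems.RuelleBandExactFirstBand.stub_oddSectorCriterion`
(`Summits/RiemannHypothesis/RiemannHypothesis/Theorems/RuelleBandExactFirstBandStubOddSectorCriterion.lean`:
positivity on odd REAL-valued tests already forces every zero with `0 < Re s < 1` onto the critical
line or the real axis; with `riemannZeta_ofReal_ne_zero_of_pos_of_lt_one` and
`riemannHypothesis_iff_strip_holds` this gives the hard half below). Literature cannot import
`Summits/` (CONVENTIONS §2), so the fact stays undischarged here until that argument, or Yoshida's,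
is carried out inside `Literature/`.

## Contents

* `yoshida_odd_criterion` — NAMED FACT (D-0014), Proposition 1(1) for `k = ℚ`.
* `yoshida_odd_criterion_mp` — the "if" half, PROVED (RH ⇒ odd-sector positivity).
* `yoshida_odd_criterion.riemannHypothesis`, `yoshida_odd_criterion.exists_odd_neg` — the hard
  half as an implication and in the contrapositive form used by route `OddSector`
  (`Summits/RiemannHypothesis/RiemannHypothesis/Theses/OddSector.lean`, crux `OddNegativityOffLine`).

Proposition 1(2) (even sector: RH up to real zeros) is NOT vendored here (no requester; its
`ζ`-case is the Summit-side `stub_evenTransfer` of the same Theorems cluster).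

## References

* H. Yoshida, *On Hermitian forms attached to zeta functions*, Adv. Stud. Pure Math. 21 (1992),
  281–325, §1 Prop. 1 and Lemma 1 (Zbl 0817.11041).
* E. Bombieri, *Remarks on Weil's quadratic functional in the theory of prime numbers I*, Rend.
  Mat. Acc. Lincei (9) 11 (2000), 183–233, §3 Thms. 1–2 (Weil's criterion), §4 Thm. 5 (the odd and
  even infima `μ^±(M)`).
* A. Weil, *Sur les "formules explicites" de la théorie des nombres premiers* (1952).
-/

noncomputable section

namespace Literature.NumberTheory.LFunctions

/-- **Yoshida 1992, Proposition 1(1)** (odd-sector Weil criterion), case `k = ℚ`. With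
`T(F) = lim_{T → ∞} ∑_{|Im ρ| < T} M(F)(ρ)` the zero-side distribution of `ζ` over its non-trivial
zeros, `M(F)(s) = ∫ F(x) e^{(s - 1/2)x} dx`, `α̃(x) = conj α(-x)`: "`T_k` is oddly positive definite"
— `T(α * α̃) ≥ 0` for every ODD `α ∈ C_c^∞(ℝ)` — "if and only if R.H. holds for `ζ_k(s)`". Stated
for `k = ℚ` in the tree's (identical) normalisation, with the zero side `T(α * α̃)` written as
`W(α ⋆ α̃) = weilQuadratic α`, to which it is equal by the explicit formula (Yoshida (1.6); tree:
`explicit_formula_holds` with `WeilConverse.hasWeilZeroSide_zeroForm`). The "if" half is proved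
below (`yoshida_odd_criterion_mp`); the "only if" half (an odd test `α₁ + α₂ - α̌₁ - α̌₂` of negative
energy built from an off-line zero, Lemma 1 pp. 285–286) is the content of this fact.
[cite: Yoshida1992HermitianForms, Prop. 1(1) (p. 285; proof pp. 286–287)] -/
def yoshida_odd_criterion : Prop :=
  RiemannHypothesis ↔
    ∀ g : ℝ → ℂ, IsWeilTest g → (∀ t : ℝ, g (-t) = -g t) → 0 ≤ (weilQuadratic g).re

-- TODO(general form): Yoshida states Proposition 1 for the Dedekind zeta function `ζ_k` of any
-- number field `k` (zero-side distribution `T_k`, explicit formula (1.6) with `log A_k`,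
-- `r₁ V₁ + 2 r₂ V₂`); the tree's Weil functional (`WeilExplicit.lean`) is set up for `ζ = ζ_ℚ` only.

/-- **The "if" half of Yoshida 1992 Prop. 1(1), proved**: under the Riemann hypothesis
`Re W(g ⋆ g̃) ≥ 0` for every odd test function `g` — indeed for every test function, by the easy
half of Weil's criterion (`WeilPositivity.of_riemannHypothesis`, Bombieri 2000 Thm. 1 (3.2):
`1 - ρ = ρ̄` makes the zero side `∑ m(ρ) |ĝ(ρ)|²`) and the discharged explicit formula
`explicit_formula_holds`; oddness is not used (Yoshida, p. 286: "This proves if parts of (1) and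
(2)"). [cite: Yoshida1992HermitianForms, Prop. 1(1), "if" part (p. 286)] -/
theorem yoshida_odd_criterion_mp (hRH : RiemannHypothesis) (g : ℝ → ℂ) (hg : IsWeilTest g)
    (_hodd : ∀ t : ℝ, g (-t) = -g t) : 0 ≤ (weilQuadratic g).re :=
  WeilPositivity.of_riemannHypothesis explicit_formula_holds hRH g hg

/-- The hard half as an implication: odd-sector Weil positivity implies the Riemann hypothesis
(Yoshida 1992 Prop. 1(1), "only if"), given the named fact. [cite: Yoshida1992HermitianForms, Prop. 1(1), "only if" part (pp. 286–287)] -/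
theorem yoshida_odd_criterion.riemannHypothesis (h : yoshida_odd_criterion)
    (hpos : ∀ g : ℝ → ℂ, IsWeilTest g → (∀ t : ℝ, g (-t) = -g t) → 0 ≤ (weilQuadratic g).re) :
    RiemannHypothesis :=
  h.2 hpos

/-- The hard half in contrapositive form (the shape used by route `OddSector`, crux
`OddNegativityOffLine`): if the Riemann hypothesis fails, some smooth compactly supported ODD `g`
has `Re W(g ⋆ g̃) < 0` (Yoshida's witness `α₁ + α₂ - α̌₁ - α̌₂`, p. 286), given the named fact.
[cite: Yoshida1992HermitianForms, Prop. 1(1), proof p. 286] -/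
theorem yoshida_odd_criterion.exists_odd_neg (h : yoshida_odd_criterion)
    (hRH : ¬ RiemannHypothesis) :
    ∃ g : ℝ → ℂ, IsWeilTest g ∧ (∀ t : ℝ, g (-t) = -g t) ∧ (weilQuadratic g).re < 0 := by
  by_contra hne
  push Not at hne
  exact hRH (h.2 fun g hg hodd ↦ hne g hg hodd)

/-- Given the named fact, Yoshida's Prop. 1(1) for `ℚ` and the tree's (proved) parity-free Weil
criterion `weil_criterion_holds` combine to: Weil positivity on ALL test functions is equivalent to
Weil positivity on the ODD ones. [cite: Yoshida1992HermitianForms, Prop. 1(1) with Weil's criterion (p. 285)] -/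
theorem yoshida_odd_criterion.weilPositivity_iff_odd (h : yoshida_odd_criterion) :
    WeilPositivity ↔
      ∀ g : ℝ → ℂ, IsWeilTest g → (∀ t : ℝ, g (-t) = -g t) → 0 ≤ (weilQuadratic g).re :=
  weil_criterion_holds.symm.trans h

end Literature.NumberTheory.LFunctions

end
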